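import Literature.Computability.Cryptography.QuantumTuringMachineUnidirection
import HarnessLib

/-!
# Bernstein–Vazirani's unidirection lemma, II: five steps of `M'` are one step of `M`

Sequel of `QuantumTuringMachineUnidirection.lean` (the machine `M' = QTM.unidir M B` of
Bernstein–Vazirani 1997, Lemma 5.5, p. 1436, unidirectional and well formed with `C̃`
amplitudes). Here: the SIMULATION — the phase-by-phase action of `M'` on basis states
(`pevolve_phase0` … `pevolve_phase4`), the intertwining of five steps of `M'` with one step of
`M` under the relabelling `|q, T, ξ⟩ ↦ |(q,0), T, ξ⟩`, the equality of acceptance probabilities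
at times `5t` and `t`, and the packaged statement **`unidirection`** (hypothesis `hUni` of
`BQPQTMPos_subset_BQP_of_unidirection_of_SK`, `QuantumComplexity/QuantumTuringYao.lean`).
No named facts.

## References

* E. Bernstein, U. Vazirani, *Quantum complexity theory*, SIAM J. Comput. 26 (1997) 1411–1473
  [BernsteinVaziraniSICOMP1997]: Lemma 5.4, Lemma 5.5 and its proof (p. 1436).
-/

noncomputable section

namespace Literature.Computability.Cryptography

namespace QTM

open Turing Finsupp
open scoped BigOperators ComplexConjugate InnerProductSpace

variable {M : QTM} (B : M.AdaptedBasis)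

/-! ### One step of `M'` from a basis state -/

/-- The basis configuration of `M'` with state `(q, k)`, tape `T`, position `ξ`. [folklore] -/
abbrev ucfg (q : M.Λ) (k : Fin 5) (T : Tape M.Γ) (ξ : ℤ) : (M.unidir B).PCfg :=
  (((⟨(q, k), T⟩ : (M.unidir B).Cfg)), ξ)

/-- **One step of `M'` from phase `k`** enters phase `k' = k + 1` only:
`U' |(p,k), T, ξ⟩ = ∑_{q,τ} A_{k,k'}(p,T(ξ),q,τ,L) |(q,k'), T_ξ^τ, ξ-1⟩ + A_{k,k'}(…,R) |(q,k'), T_ξ^τ, ξ+1⟩`. [cite: BernsteinVaziraniSICOMP1997, Lemma 5.4] -/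
theorem pevolve_unidir_single (k k' : Fin 5) (hk : k' = k + 1) (p : M.Λ) (T : Tape M.Γ) (ξ : ℤ) (a : ℂ) :
    (M.unidir B).pevolve (Finsupp.single (ucfg B p k T ξ) a) =
      ∑ q : M.Λ, ∑ τ : M.Γ,
        ((a * phaseAmp B k k' p T.head q τ Dir.left) • Finsupp.single (ucfg B q k' ((T.write τ).move Dir.left) (ξ - 1)) (1 : ℂ) +
          (a * phaseAmp B k k' p T.head q τ Dir.right) •
            Finsupp.single (ucfg B q k' ((T.write τ).move Dir.right) (ξ + 1)) (1 : ℂ)) := by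
  rw [(M.unidir B).pevolve_single_eq_sum, sub_eq_add_neg ξ 1]
  simp only [Fintype.sum_prod_type, Fintype.sum_bool, updAmp, pupdTarget, updTarget, unidir_δ, dirOfBool_true,
    dirOfBool_false, shiftOfBool_true, shiftOfBool_false]
  erw [Fintype.sum_prod_type, Fintype.sum_prod_type]
  rw [← Finset.sum_add_distrib]
  refine Finset.sum_congr rfl fun q _ => ?_
  dsimp only
  rw [Finset.sum_eq_single k', Finset.sum_eq_single k', ← Finset.sum_add_distrib]
  · exact Finset.sum_congr rfl fun τ _ => add_comm _ _
  · intro k'' _ hk''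
    exact Finset.sum_eq_zero fun τ _ => by
      rw [phaseAmp_eq_zero_of_ne B (hk ▸ hk''), mul_zero, zero_smul]
  · exact fun hh => absurd (Finset.mem_univ _) hh
  · intro k'' _ hk''
    exact Finset.sum_eq_zero fun τ _ => by
      rw [phaseAmp_eq_zero_of_ne B (hk ▸ hk''), mul_zero, zero_smul]
  · exact fun hh => absurd (Finset.mem_univ _) hh

/-- **Phase 0**: step right. [cite: BernsteinVaziraniSICOMP1997, Lemma 5.5 (proof)] -/
theorem pevolve_phase0 (p : M.Λ) (T : Tape M.Γ) (ξ : ℤ) (a : ℂ) :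
    (M.unidir B).pevolve (Finsupp.single (ucfg B p 0 T ξ) a) = Finsupp.single (ucfg B p 1 (T.move Dir.right) (ξ + 1)) a := by
  rw [pevolve_unidir_single B 0 1 rfl]
  simp only [phaseAmp_zero, reduceCtorEq, and_false, if_false, mul_zero, zero_smul, zero_add, and_true, ite_and, mul_ite,
    mul_one, ite_smul, Finsupp.smul_single_one]
  rw [Finset.sum_eq_single p]
  · simp only [if_true, Finset.sum_ite_eq', Finset.mem_univ, Tape.write_self]
  · intro q _ hq; simp [hq]
  · exact fun hh => absurd (Finset.mem_univ _) hh

/-- **Phase 4**: step right, back to phase `0`. [cite: BernsteinVaziraniSICOMP1997, Lemma 5.5 (proof)] -/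
theorem pevolve_phase4 (p : M.Λ) (T : Tape M.Γ) (ξ : ℤ) (a : ℂ) :
    (M.unidir B).pevolve (Finsupp.single (ucfg B p 4 T ξ) a) = Finsupp.single (ucfg B p 0 (T.move Dir.right) (ξ + 1)) a := by
  rw [pevolve_unidir_single B 4 0 rfl]
  simp only [phaseAmp_four, reduceCtorEq, and_false, if_false, mul_zero, zero_smul, zero_add, and_true, ite_and, mul_ite,
    mul_one, ite_smul, Finsupp.smul_single_one]
  rw [Finset.sum_eq_single p]
  · simp only [if_true, Finset.sum_ite_eq', Finset.mem_univ, Tape.write_self]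
  · intro q _ hq; simp [hq]
  · exact fun hh => absurd (Finset.mem_univ _) hh

/-- **Phase 1**: change basis `|p⟩ ↦ ∑_i ⟨p|b_i⟩ |i⟩` stepping left. [cite: BernsteinVaziraniSICOMP1997, Lemma 5.5 (proof)] -/
theorem pevolve_phase1 (p : M.Λ) (T : Tape M.Γ) (ξ : ℤ) (a : ℂ) :
    (M.unidir B).pevolve (Finsupp.single (ucfg B p 1 T ξ) a) =
      ∑ i : M.Λ, (a * conj ((B.b i : EuclideanSpace ℂ M.Λ) p)) • Finsupp.single (ucfg B i 2 (T.move Dir.left) (ξ - 1)) (1 : ℂ) := by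
  rw [pevolve_unidir_single B 1 2 rfl]
  simp only [phaseAmp_one, reduceCtorEq, and_false, if_false, mul_zero, zero_smul, add_zero, and_true, mul_ite,
    ite_smul, Finset.sum_ite_eq', Finset.mem_univ, if_true, Tape.write_self]

/-- **Phase 3**: change basis back `|j⟩ ↦ ∑_p ⟨b_j|p⟩ |p⟩` stepping left. [cite: BernsteinVaziraniSICOMP1997, Lemma 5.5 (proof)] -/
theorem pevolve_phase3 (j : M.Λ) (T : Tape M.Γ) (ξ : ℤ) (a : ℂ) :
    (M.unidir B).pevolve (Finsupp.single (ucfg B j 3 T ξ) a) =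
      ∑ q : M.Λ, (a * (B.b j : EuclideanSpace ℂ M.Λ) q) • Finsupp.single (ucfg B q 4 (T.move Dir.left) (ξ - 1)) (1 : ℂ) := by
  rw [pevolve_unidir_single B 3 4 rfl]
  simp only [phaseAmp_three, reduceCtorEq, and_false, if_false, mul_zero, zero_smul, add_zero, and_true, mul_ite,
    ite_smul, Finset.sum_ite_eq', Finset.mem_univ, if_true, Tape.write_self]

/-- **Phase 2**: one step of `M` in the basis `b` (`deltaB`). [cite: BernsteinVaziraniSICOMP1997, Lemma 5.5 (proof)] -/
theorem pevolve_phase2 (i : M.Λ) (T : Tape M.Γ) (ξ : ℤ) (a : ℂ) :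
    (M.unidir B).pevolve (Finsupp.single (ucfg B i 2 T ξ) a) =
      ∑ j : M.Λ, ∑ τ : M.Γ,
        ((a * deltaB B i T.head j τ Dir.left) • Finsupp.single (ucfg B j 3 ((T.write τ).move Dir.left) (ξ - 1)) (1 : ℂ) +
          (a * deltaB B i T.head j τ Dir.right) • Finsupp.single (ucfg B j 3 ((T.write τ).move Dir.right) (ξ + 1)) (1 : ℂ)) := by
  rw [pevolve_unidir_single B 2 3 rfl]
  simp only [phaseAmp_two]

/-! ### The phase encodings and the intertwining relations -/

/-- Phase-`0` encoding (the relabelling `|q,T,ξ⟩ ↦ |(q,0),T,ξ⟩`). [cite: BernsteinVaziraniSICOMP1997, Lemma 5.5 (proof)] -/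
def E0 : (M.PCfg →₀ ℂ) →ₗ[ℂ] ((M.unidir B).PCfg →₀ ℂ) :=
  Finsupp.lmapDomain ℂ ℂ fun c => ucfg B c.1.q 0 c.1.tape c.2

/-- Phase-`1` encoding (after the right step). [folklore] -/
def E1 : (M.PCfg →₀ ℂ) →ₗ[ℂ] ((M.unidir B).PCfg →₀ ℂ) :=
  Finsupp.lmapDomain ℂ ℂ fun c => ucfg B c.1.q 1 (c.1.tape.move Dir.right) (c.2 + 1)

/-- Phase-`2` encoding (the state expanded in the basis `b`). [folklore] -/
def E2 : (M.PCfg →₀ ℂ) →ₗ[ℂ] ((M.unidir B).PCfg →₀ ℂ) :=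
  Finsupp.linearCombination ℂ fun c : M.PCfg =>
    ∑ i : M.Λ, conj ((B.b i : EuclideanSpace ℂ M.Λ) c.1.q) • Finsupp.single (ucfg B i 2 c.1.tape c.2) (1 : ℂ)

/-- Phase-`3` encoding (same expansion, phase `3`). [folklore] -/
def E3 : (M.PCfg →₀ ℂ) →ₗ[ℂ] ((M.unidir B).PCfg →₀ ℂ) :=
  Finsupp.linearCombination ℂ fun c : M.PCfg =>
    ∑ j : M.Λ, conj ((B.b j : EuclideanSpace ℂ M.Λ) c.1.q) • Finsupp.single (ucfg B j 3 c.1.tape c.2) (1 : ℂ)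

/-- Phase-`4` encoding (before the final right step). [folklore] -/
def E4 : (M.PCfg →₀ ℂ) →ₗ[ℂ] ((M.unidir B).PCfg →₀ ℂ) :=
  Finsupp.lmapDomain ℂ ℂ fun c => ucfg B c.1.q 4 (c.1.tape.move Dir.left) (c.2 - 1)

/-- Phase 0 → 1 on encodings. [cite: BernsteinVaziraniSICOMP1997, Lemma 5.5 (proof)] -/
theorem pevolve_E0 (ψ : M.PCfg →₀ ℂ) : (M.unidir B).pevolve (E0 B ψ) = E1 B ψ := by
  suffices h : (M.unidir B).pevolveLin ∘ₗ E0 B = E1 B from LinearMap.congr_fun h ψ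
  refine Finsupp.lhom_ext fun c a => ?_
  simp only [LinearMap.comp_apply, E0, E1, Finsupp.lmapDomain_apply, Finsupp.mapDomain_single, pevolveLin_apply]
  exact pevolve_phase0 B c.1.q c.1.tape c.2 a

/-- Phase 1 → 2 on encodings. [cite: BernsteinVaziraniSICOMP1997, Lemma 5.5 (proof)] -/
theorem pevolve_E1 (ψ : M.PCfg →₀ ℂ) : (M.unidir B).pevolve (E1 B ψ) = E2 B ψ := by
  suffices h : (M.unidir B).pevolveLin ∘ₗ E1 B = E2 B from LinearMap.congr_fun h ψ
  refine Finsupp.lhom_ext fun c a => ?_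
  simp only [LinearMap.comp_apply, E1, E2, Finsupp.lmapDomain_apply, Finsupp.mapDomain_single, pevolveLin_apply,
    Finsupp.linearCombination_single]
  rw [pevolve_phase1, Tape.move_right_left, add_sub_cancel_right, Finset.smul_sum]
  exact Finset.sum_congr rfl fun i _ => by rw [smul_smul]

/-- The change-of-basis identity behind phase `2`:
`∑_i conj(b_i p) δ'(b_i,σ,τ,b_j,d) = ⟪b_j, δ(p,σ|τ,d)⟫ = ∑_q conj(b_j q) δ(p,σ,q,τ,d)`. [cite: BernsteinVaziraniSICOMP1997, Lemma 5.1] -/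
theorem sum_conj_mul_deltaB (p : M.Λ) (σ : M.Γ) (j : M.Λ) (τ : M.Γ) (d : Dir) :
    ∑ i, conj ((B.b i : EuclideanSpace ℂ M.Λ) p) * deltaB B i σ j τ d =
      ∑ q, conj ((B.b j : EuclideanSpace ℂ M.Λ) q) * M.δ p σ q τ d := by
  unfold deltaB
  simp_rw [Finset.mul_sum]
  rw [Finset.sum_comm]
  have : ∀ p₀, ∑ i, conj ((B.b i : EuclideanSpace ℂ M.Λ) p) * ((B.b i : EuclideanSpace ℂ M.Λ) p₀ *
      ⟪(B.b j : EuclideanSpace ℂ M.Λ), M.rvec p₀ σ τ d⟫_ℂ) =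
      (if p = p₀ then 1 else 0) * ⟪(B.b j : EuclideanSpace ℂ M.Λ), M.rvec p₀ σ τ d⟫_ℂ := by
    intro p₀
    rw [← B.sum_conj_mul p p₀, Finset.sum_mul]
    exact Finset.sum_congr rfl fun i _ => by ring
  simp_rw [this]
  simp only [ite_mul, one_mul, zero_mul, Finset.sum_ite_eq, Finset.mem_univ, if_true]
  rw [PiLp.inner_apply]
  simp only [rvec_apply, RCLike.inner_apply]
  exact Finset.sum_congr rfl fun q _ => mul_comm _ _

/-- Phase 2 → 3 on encodings intertwines with one step of `M`. [cite: BernsteinVaziraniSICOMP1997, Lemma 5.5 (proof)] -/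
theorem pevolve_E2 (ψ : M.PCfg →₀ ℂ) : (M.unidir B).pevolve (E2 B ψ) = E3 B (M.pevolve ψ) := by
  suffices h : (M.unidir B).pevolveLin ∘ₗ E2 B = E3 B ∘ₗ M.pevolveLin from LinearMap.congr_fun h ψ
  refine Finsupp.lhom_ext fun c a => ?_
  obtain ⟨⟨p, T⟩, ξ⟩ := c
  simp only [LinearMap.comp_apply, E2, E3, pevolveLin_apply, Finsupp.linearCombination_single, map_smul, map_sum]
  -- left: `a • ∑_i conj(b_i p) • U'|(i,2),T,ξ⟩`
  simp_rw [pevolve_phase2 B _ T ξ 1, one_mul]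
  -- right: `E3 (U |p,T,ξ⟩)`
  rw [M.pevolve_single_eq_sum, map_sum]
  simp only [map_smul, Finsupp.linearCombination_single, one_smul]
  change a • _ = ∑ u : Bool × M.Λ × M.Γ, _
  simp only [Fintype.sum_prod_type, Fintype.sum_bool, updAmp, pupdTarget, updTarget, dirOfBool_true, dirOfBool_false,
    shiftOfBool_true, shiftOfBool_false, ← sub_eq_add_neg]
  -- both sides as `∑_j ∑_τ (cL • sL + cR • sR)`
  simp_rw [Finset.smul_sum, smul_add, smul_smul]
  rw [Finset.sum_comm]
  -- left: for each `j`, collect the coefficients through the change-of-basis identity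
  have hcoef : ∀ (y : M.Λ) (x_1 : M.Γ) (d : Dir),
      (∑ x : M.Λ, a * (conj ((B.b x : EuclideanSpace ℂ M.Λ) p) * deltaB B x T.head y x_1 d)) =
        ∑ q' : M.Λ, a * (M.δ p T.head q' x_1 d * conj ((B.b y : EuclideanSpace ℂ M.Λ) q')) := by
    intro y x_1 d
    rw [← Finset.mul_sum, sum_conj_mul_deltaB, Finset.mul_sum]
    exact Finset.sum_congr rfl fun q' _ => by ring
  have hL : ∀ y : M.Λ, (∑ x : M.Λ, ∑ x_1 : M.Γ,
      ((a * (conj ((B.b x : EuclideanSpace ℂ M.Λ) p) * deltaB B x T.head y x_1 Dir.left)) •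
          Finsupp.single (ucfg B y 3 ((T.write x_1).move Dir.left) (ξ - 1)) (1 : ℂ) +
        (a * (conj ((B.b x : EuclideanSpace ℂ M.Λ) p) * deltaB B x T.head y x_1 Dir.right)) •
          Finsupp.single (ucfg B y 3 ((T.write x_1).move Dir.right) (ξ + 1)) (1 : ℂ))) =
      ∑ x_1 : M.Γ, ∑ q' : M.Λ,
        ((a * (M.δ p T.head q' x_1 Dir.left * conj ((B.b y : EuclideanSpace ℂ M.Λ) q'))) •
            Finsupp.single (ucfg B y 3 ((T.write x_1).move Dir.left) (ξ - 1)) (1 : ℂ) +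
          (a * (M.δ p T.head q' x_1 Dir.right * conj ((B.b y : EuclideanSpace ℂ M.Λ) q'))) •
            Finsupp.single (ucfg B y 3 ((T.write x_1).move Dir.right) (ξ + 1)) (1 : ℂ)) := by
    intro y
    rw [Finset.sum_comm]
    refine Finset.sum_congr rfl fun x_1 _ => ?_
    rw [Finset.sum_add_distrib, Finset.sum_add_distrib, ← Finset.sum_smul, ← Finset.sum_smul, ← Finset.sum_smul,
      ← Finset.sum_smul, hcoef, hcoef]
  simp only [hL]
  -- left: `∑ j, ∑ τ, ∑ q', (L + R)` → `∑ τ, ∑ q', ∑ j, (L + R)`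
  rw [Finset.sum_comm]
  refine (Finset.sum_congr rfl fun x_1 _ => Finset.sum_comm).trans ?_
  -- split both sides into their `L` and `R` parts and compare termwise
  symm
  simp only [Finset.sum_add_distrib]
  rw [add_comm]
  congr 1
  · rw [Finset.sum_comm]
    exact Finset.sum_congr rfl fun x_1 _ => Finset.sum_congr rfl fun q' _ => Finset.sum_congr rfl fun y _ => by
      congr 1; ring
  · rw [Finset.sum_comm]
    exact Finset.sum_congr rfl fun x_1 _ => Finset.sum_congr rfl fun q' _ => Finset.sum_congr rfl fun y _ => by
      congr 1; ring

/-- Phase 3 → 4 on encodings. [cite: BernsteinVaziraniSICOMP1997, Lemma 5.5 (proof)] -/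
theorem pevolve_E3 (ψ : M.PCfg →₀ ℂ) : (M.unidir B).pevolve (E3 B ψ) = E4 B ψ := by
  suffices h : (M.unidir B).pevolveLin ∘ₗ E3 B = E4 B from LinearMap.congr_fun h ψ
  refine Finsupp.lhom_ext fun c a => ?_
  obtain ⟨⟨q, T⟩, ξ⟩ := c
  simp only [LinearMap.comp_apply, E3, E4, pevolveLin_apply, Finsupp.linearCombination_single, map_smul, map_sum,
    Finsupp.lmapDomain_apply, Finsupp.mapDomain_single]
  simp_rw [pevolve_phase3 B _ T ξ 1, one_mul, Finset.smul_sum, smul_smul]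
  rw [Finset.sum_comm]
  have h : ∀ y : M.Λ, (∑ x : M.Λ, (a * (conj ((B.b x : EuclideanSpace ℂ M.Λ) q) * (B.b x : EuclideanSpace ℂ M.Λ) y)) •
      Finsupp.single (ucfg B y 4 (T.move Dir.left) (ξ - 1)) (1 : ℂ)) =
      (a * (if q = y then 1 else 0)) • Finsupp.single (ucfg B y 4 (T.move Dir.left) (ξ - 1)) (1 : ℂ) := fun y => by
    rw [← Finset.sum_smul, ← Finset.mul_sum, B.sum_conj_mul]
  simp only [h]
  simp only [mul_ite, mul_one, mul_zero, ite_smul, zero_smul, Finset.sum_ite_eq, Finset.mem_univ, if_true,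
    Finsupp.smul_single_one]

/-- Phase 4 → 0 on encodings. [cite: BernsteinVaziraniSICOMP1997, Lemma 5.5 (proof)] -/
theorem pevolve_E4 (ψ : M.PCfg →₀ ℂ) : (M.unidir B).pevolve (E4 B ψ) = E0 B ψ := by
  suffices h : (M.unidir B).pevolveLin ∘ₗ E4 B = E0 B from LinearMap.congr_fun h ψ
  refine Finsupp.lhom_ext fun c a => ?_
  simp only [LinearMap.comp_apply, E4, E0, Finsupp.lmapDomain_apply, Finsupp.mapDomain_single, pevolveLin_apply]
  rw [pevolve_phase4, Tape.move_left_right, sub_add_cancel]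

/-- **Five steps of `M'` carry out one step of `M`** (Bernstein–Vazirani 1997, Lemma 5.5: "M'
simulates M with slowdown by a factor of 5"). [cite: BernsteinVaziraniSICOMP1997, Lemma 5.5] -/
theorem pevolve_five (ψ : M.PCfg →₀ ℂ) : (M.unidir B).pevolve^[5] (E0 B ψ) = E0 B (M.pevolve ψ) := by
  show (M.unidir B).pevolve ((M.unidir B).pevolve ((M.unidir B).pevolve ((M.unidir B).pevolve
    ((M.unidir B).pevolve (E0 B ψ))))) = _
  rw [pevolve_E0, pevolve_E1, pevolve_E2, pevolve_E3, pevolve_E4]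

/-- **`M'` at time `5t` is `M` at time `t`, relabelled.** [cite: BernsteinVaziraniSICOMP1997, Lemma 5.5] -/
theorem pstateAt_unidir (x : List Bool) (t : ℕ) : (M.unidir B).pstateAt x (5 * t) = E0 B (M.pstateAt x t) := by
  induction t with
  | zero =>
    show Finsupp.single ((M.unidir B).pinit x) 1 = E0 B (Finsupp.single (M.pinit x) 1)
    rw [E0, Finsupp.lmapDomain_apply, Finsupp.mapDomain_single]
    rfl
  | succ t ih =>
    rw [show 5 * (t + 1) = 5 + 5 * t by ring, pstateAt, Function.iterate_add_apply, ← pstateAt, ih, pevolve_five,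
      ← pstateAt_succ]

/-- **Equal acceptance probabilities**: `M'` observed after `5t` steps accepts exactly as often as
`M` observed after `t` steps (the accepting state of `M'` is `(accept, 0)`). [cite: BernsteinVaziraniSICOMP1997, Lemma 5.5] -/
theorem pacceptProbAt_unidir (x : List Bool) (t : ℕ) : (M.unidir B).pacceptProbAt x (5 * t) = M.pacceptProbAt x t := by
  unfold pacceptProbAt
  rw [pstateAt_unidir, E0, Finsupp.lmapDomain_apply,
    Finsupp.sum_mapDomain_index_inj (fun c c' h => by
      obtain ⟨⟨q, T⟩, ξ⟩ := c
      obtain ⟨⟨q', T'⟩, ξ'⟩ := c'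
      have h1 := congrArg (fun z : (M.unidir B).PCfg => (z.1.q.1, z.1.tape, z.2)) h
      simp only [Prod.mk.injEq] at h1
      obtain ⟨rfl, rfl, rfl⟩ := h1
      rfl)]
  refine Finsupp.sum_congr fun c _ => ?_
  show (if ((c.1.q, (0 : Fin 5)) : M.Λ × Fin 5) = (M.accept, 0) then ‖_‖ ^ 2 else 0) = _
  simp only [Prod.mk.injEq, and_true]

/-! ### The unidirection lemma -/

/-- **Bernstein–Vazirani 1997, Lemma 5.5 (unidirection lemma), positioned model, inside `C̃`.**
For every Bernstein–Vazirani well-formed QTM `M` with polynomial-time computable amplitudes and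
every polynomial `p` there are a UNIDIRECTIONAL BV-well-formed QTM `M'` with polynomial-time
computable amplitudes and the polynomial `5p` such that `M'` observed after `5 p(|x|)` steps
accepts every input `x` with exactly the probability with which `M` observed after `p(|x|)`
steps does. (`M' = QTM.unidir M B` for an adapted `C̃` basis `B` from
`exists_orthonormal_adapted_polyTime`.) This is hypothesis `hUni` of
`BQPQTMPos_subset_BQP_of_unidirection_of_SK`. [cite: BernsteinVaziraniSICOMP1997, Lemma 5.5] -/
theorem unidirection (M : QTM) (p : Polynomial ℕ) (hwf : M.PIsWellFormed)
    (hamp : M.amplitudes ⊆ polyTimeComputableComplex) :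
    ∃ (M' : QTM) (D : M'.Λ → Dir) (p' : Polynomial ℕ), M'.IsUnidirectionalWith D ∧ M'.PIsWellFormed ∧
      M'.amplitudes ⊆ polyTimeComputableComplex ∧
        ∀ x : List Bool, M'.pacceptProbAt x (p'.eval x.length) = M.pacceptProbAt x (p.eval x.length) := by
  classical
  haveI : Nonempty M.Λ := ⟨M.start⟩
  have hloc : M.IsLocallyWellFormed := hwf.isLocallyWellFormed
  obtain ⟨b, hon, hpc, hadapt⟩ := exists_orthonormal_adapted_polyTime M.rvecR fun k => polyTimeVec_rvec hamp _ _ _ _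
  have hsp : ⊤ ≤ Submodule.span ℂ (Set.range b) := by
    have hb := (basisOfOrthonormalOfCardEqFinrank hon (finrank_euclideanSpace.symm)).span_eq
    rw [coe_basisOfOrthonormalOfCardEqFinrank] at hb
    exact hb.ge
  let ob : OrthonormalBasis M.Λ ℂ (EuclideanSpace ℂ M.Λ) := OrthonormalBasis.mk hon hsp
  have hob : ∀ i, (ob i : EuclideanSpace ℂ M.Λ) = b i := fun i => OrthonormalBasis.coe_mk hon hsp ▸ rfl
  let B : M.AdaptedBasis :=
    { b := ob
      tag := fun i => if b i ∈ M.spaceR then Dir.right else Dir.left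
      mem_of_right := fun i hi => by
        by_cases h : b i ∈ M.spaceR
        · rw [hob]; exact h
        · simp [h] at hi
      mem_of_left := fun i hi => by
        by_cases h : b i ∈ M.spaceR
        · simp [h] at hi
        · rw [hob]
          rcases hadapt i with h' | h'
          · exact absurd h' h
          · exact h' }
  refine ⟨M.unidir B, unidirDir B, 5 * p, unidir_isUnidirectionalWith B hloc, unidir_pIsWellFormed B hloc,
    unidir_amplitudes_subset B hamp (fun i => by rw [show (B.b i : EuclideanSpace ℂ M.Λ) = b i from hob i]; exact hpc i),
    fun x => ?_⟩
  rw [Polynomial.eval_mul, show (5 : Polynomial ℕ).eval x.length = 5 by simp]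
  exact pacceptProbAt_unidir B x (p.eval x.length)

end QTM

end Literature.Computability.Cryptography

end
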